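import Summits.BirchSwinnertonDyer.Rank1Residual.F1Sign2.RamifiedNormIndexFramesAtTwo
import Literature.NumberTheory.EllipticCurves.KramerTunnell1982.GoodReductionUnramifiedNormIndexProofs
import HarnessLib

/-!
# Route `GenusKolyvaginAtTwo`, crux #2 `GenusPrimitiveSupplyAtTwo` (stmt-BirchSwinnertonDyer-22136):
# THE CELL'S DESC-N `F1Sign2.TwoTorsionNormCriterion` IS A THEOREM — «`T = (0,0)` is a norm from `E(F(√d))` iff the quartic
# `s² = d((w² − a)² − 4b)` has an `F`-point», by the LINE THROUGH `T` (no isogeny), and with it DESC-C `TwoTorsionNormHilbertObstruction`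

Width seat `bsd-line-gk2-p4` g14 (cell `bsd-f1-sign2`); -ty g12 p665620 typed DESC-§25 (-desc g17 MEMO-desc §25) and left DESC-N «Mathlib
group-law computation, L-size, for a width seat». THEOREMS ONLY (no definition, no named fact, no `sorry`); helper
`--supports stmt-BirchSwinnertonDyer-22136` (the ramified quadratic norm index at a `2`-torsion prime is the local input `i_v` of the
twist/door calculus of this lane); no item is closed; BSD is not proved by any of this.

WHAT. `E : y² = x(x² + ax + b)` over a field `F` with `2 ≠ 0`, `b(a² − 4b) ≠ 0`, `T = (0,0)`, `K' = F(√d)` quadratic (`r² = d`, `σ ≠ 1`):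
`T ∈ N_{K'/F} E(K')` (tree `KramerTunnell1982.normSubgroup`: `∃ P, P + σP = T`) **iff** `∃ w s : F, d((w² − a)² − 4b) = s²`.

PROOF (the line through `T`; elementary, replaces the sketch's 2-isogeny route). `P + σP = T` says that `P`, `σP` and `−T = T` are
collinear: `P = (x, ℓx)` lies on a line `y = ℓx` through the origin, with `ℓ = y/x` FIXED by `σ` (both `P` and `σP` are on it), i.e.
`ℓ = w ∈ F`; substituting, `x` is a root of `X² + (a − w²)X + b`, so `z = 2x + a − w²` has `z² = (w² − a)² − 4b =: D ∈ F`, whence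
`σz = ±z`: `σz = −z` gives `zr ∈ F`, `d·D = (zr)²`; `σz = z` gives `σx = x`, then `x + σx = ℓ² − a` forces `z = 0`, `D = 0`, `s = 0`.
Conversely from `d·D = s²` put `ℓ = w`, `z = (s/d)·r` (`z² = D`, `σz = −z`), `2x = ℓ² − a + z`, `y = ℓx`: then `P = (x, y) ∈ E(K')`,
`σP = (σx, ℓσx)` with `x + σx = ℓ² − a`, and the chord (or, when `s = 0`, the tangent) `y = ℓx` gives `P + σP = (ℓ² − a − x − σx, …) = T`.
Main theorems: `exists_quartic_of_torsion_mem_normSubgroup` (⟹), `torsion_mem_normSubgroup_of_quartic` (⟸),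
**`twoTorsionNormCriterion_holds : TwoTorsionNormCriterion`**, and by -ty's proved glue
**`twoTorsionNormHilbertObstruction_holds : TwoTorsionNormHilbertObstruction`** (DESC-C: `T` a norm ⟹ `(b, d)_F = 1`).

References: [Kramer1981] Props. 1–7 (quadratic norm indices); [KramerTunnell1982] §7; [SilvermanAEC2009] III.2.3 (group law), X.§4 Prop. 4.9.
-/

set_option linter.dupNamespace false -- tree convention: `Summit.BirchSwinnertonDyer.BirchSwinnertonDyer.Theorems` (summit = sub-problem)
set_option autoImplicit false

noncomputable section

open scoped Classical

namespace Summit.BirchSwinnertonDyer.BirchSwinnertonDyer.Theorems.GenusKolyTorsionNorm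

open WeierstrassCurve
open Literature.NumberTheory.EllipticCurves.KramerTunnell1982 (normSubgroup mem_normSubgroup_iff
  exists_eq_algebraMap_of_fixed_of_finrank_two)
open Summit.BirchSwinnertonDyer.Rank1Residual.F1Sign2 (twoTorsionModel TwoTorsionNormCriterion TwoTorsionNormHilbertObstruction
  twoTorsionNormHilbertObstruction_of_criterion)

variable {F : Type} [Field F] {K' : Type} [Field K'] [Algebra F K']

/-! ## §1 The quadratic extension `K' = F(r)`, `r² = d` -/

/-- `σ r = −r` for the non-trivial automorphism of the quadratic extension `K' ⊇ F(r)`, `r² = d` a non-square of `F`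
(`σr` is a square root of `d`; `σr = r` would put `r` in `K'^σ = F`). [folklore] -/
theorem algEquiv_sqrt_eq_neg (h2f : Module.finrank F K' = 2) {σ : K' ≃ₐ[F] K'} (hσ : σ ≠ 1) {d : F} (hd : ¬ IsSquare d)
    {r : K'} (hr : r ^ 2 = algebraMap F K' d) : σ r = -r := by
  have hsq : (σ r) ^ 2 = r ^ 2 := by rw [← map_pow, hr, AlgEquiv.commutes]
  have h0 : (σ r - r) * (σ r + r) = 0 := by linear_combination hsq
  rcases mul_eq_zero.mp h0 with h | h
  · exfalso
    obtain ⟨c, hc⟩ := exists_eq_algebraMap_of_fixed_of_finrank_two h2f hσ (sub_eq_zero.mp h)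
    apply hd
    refine ⟨c, (algebraMap F K').injective ?_⟩
    rw [map_mul, ← hc, ← hr, sq]
  · exact eq_neg_of_add_eq_zero_left h

/-- An element with `σz = −z` is an `F`-multiple of `1/r`: `z·r ∈ F`. [folklore] -/
theorem exists_mul_sqrt_eq_algebraMap (h2f : Module.finrank F K' = 2) {σ : K' ≃ₐ[F] K'} (hσ : σ ≠ 1) {d : F} (hd : ¬ IsSquare d)
    {r : K'} (hr : r ^ 2 = algebraMap F K' d) {z : K'} (hz : σ z = -z) : ∃ c : F, z * r = algebraMap F K' c := by
  refine exists_eq_algebraMap_of_fixed_of_finrank_two h2f hσ ?_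
  rw [map_mul, hz, algEquiv_sqrt_eq_neg h2f hσ hd hr, neg_mul_neg]

/-! ## §2 The model `y² = x(x² + ax + b)` over `K'` -/

section Model

variable (K') (a b : F)

/-- The base-changed model has `a₁ = 0`. [folklore] -/
@[simp] theorem model_a₁ : ((twoTorsionModel a b).baseChange K').a₁ = 0 := by
  simp [twoTorsionModel, WeierstrassCurve.baseChange]

/-- The base-changed model has `a₂ = a`. [folklore] -/
@[simp] theorem model_a₂ : ((twoTorsionModel a b).baseChange K').a₂ = algebraMap F K' a := by
  simp [twoTorsionModel, WeierstrassCurve.baseChange]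

/-- The base-changed model has `a₃ = 0`. [folklore] -/
@[simp] theorem model_a₃ : ((twoTorsionModel a b).baseChange K').a₃ = 0 := by
  simp [twoTorsionModel, WeierstrassCurve.baseChange]

/-- The base-changed model has `a₄ = b`. [folklore] -/
@[simp] theorem model_a₄ : ((twoTorsionModel a b).baseChange K').a₄ = algebraMap F K' b := by
  simp [twoTorsionModel, WeierstrassCurve.baseChange]

/-- The base-changed model has `a₆ = 0`. [folklore] -/
@[simp] theorem model_a₆ : ((twoTorsionModel a b).baseChange K').a₆ = 0 := by
  simp [twoTorsionModel, WeierstrassCurve.baseChange]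

/-- The equation of the base-changed model: `y² = x³ + a x² + b x`. [folklore] -/
theorem model_equation_iff (x y : K') :
    ((twoTorsionModel a b).baseChange K').toAffine.Equation x y ↔
      y ^ 2 = x ^ 3 + algebraMap F K' a * x ^ 2 + algebraMap F K' b * x := by
  rw [Affine.equation_iff]
  simp only [model_a₁, model_a₂, model_a₃, model_a₄, model_a₆, zero_mul, add_zero]

/-- `negY x y = −y` on the model. [folklore] -/
theorem model_negY (x y : K') : ((twoTorsionModel a b).baseChange K').toAffine.negY x y = -y := by
  rw [Affine.negY]
  simp only [model_a₁, model_a₃, zero_mul, sub_zero]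

/-- The discriminant of the model: `Δ = 16 b² (a² − 4b)`. [folklore] -/
theorem model_Δ : (twoTorsionModel a b).Δ = 16 * b ^ 2 * (a ^ 2 - 4 * b) := by
  simp only [twoTorsionModel, WeierstrassCurve.Δ, WeierstrassCurve.b₂, WeierstrassCurve.b₄, WeierstrassCurve.b₆,
    WeierstrassCurve.b₈]
  ring

variable {K' a b}

/-- Nonsingularity of a point of the model from its equation (`Δ ≠ 0` given `2 ≠ 0`, `b ≠ 0`, `a² − 4b ≠ 0`). [folklore] -/
theorem model_nonsingular_of_equation (h2 : (2 : F) ≠ 0) (hb : b ≠ 0) (hΔ : a ^ 2 - 4 * b ≠ 0) {x y : K'}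
    (h : ((twoTorsionModel a b).baseChange K').toAffine.Equation x y) :
    ((twoTorsionModel a b).baseChange K').toAffine.Nonsingular x y := by
  refine (Affine.equation_iff_nonsingular_of_Δ_ne_zero ?_).mp h
  have h16 : (16 : F) ≠ 0 := by
    rw [show (16 : F) = 2 * 2 * 2 * 2 by norm_num]
    exact mul_ne_zero (mul_ne_zero (mul_ne_zero h2 h2) h2) h2
  have hΔF : (twoTorsionModel a b).Δ ≠ 0 := by
    rw [model_Δ]
    exact mul_ne_zero (mul_ne_zero h16 (pow_ne_zero 2 hb)) hΔ
  change ((twoTorsionModel a b).map (algebraMap F K')).Δ ≠ 0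
  rw [WeierstrassCurve.map_Δ]
  exact (map_ne_zero_iff _ (algebraMap F K').injective).mpr hΔF

end Model

/-! ## §3 Two points of `E(K')` with prescribed coordinates are equal -/

/-- Points with equal coordinates are equal (proof irrelevance for the nonsingularity witness). [folklore] -/
theorem some_eq_some {W : Affine K'} {x₁ y₁ x₂ y₂ : K'} {h₁ : W.Nonsingular x₁ y₁} {h₂ : W.Nonsingular x₂ y₂}
    (hx : x₁ = x₂) (hy : y₁ = y₂) : Affine.Point.some x₁ y₁ h₁ = Affine.Point.some x₂ y₂ h₂ := by
  subst hx hy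
  rfl

/-! ## §4 DESC-N, direction `⟸`: an `F`-point of the quartic gives `P` with `P + σP = T` -/

/-- **DESC-N, `⟸`**: if `d((w² − a)² − 4b) = s²` with `w, s ∈ F`, then `T = (0,0)` is a norm from `E(K')`, `K' = F(√d)`:
`P = (x, wx)` with `2x = w² − a + (s/d)√d` has `P + σP = T` (chord `y = wx` through `T`; tangent when `s = 0`).
[cite: Kramer1981, Props. 1–7] [cite: SilvermanAEC2009, III.2.3] -/
theorem torsion_mem_normSubgroup_of_quartic (h2 : (2 : F) ≠ 0) {a b d : F} (hb : b ≠ 0) (hΔ : a ^ 2 - 4 * b ≠ 0)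
    (hd : ¬ IsSquare d) (h2f : Module.finrank F K' = 2) {σ : K' ≃ₐ[F] K'} (hσ : σ ≠ 1) {r : K'} (hr : r ^ 2 = algebraMap F K' d)
    (h : ((twoTorsionModel a b).baseChange K').toAffine.Nonsingular 0 0) {w s : F} (hws : d * ((w ^ 2 - a) ^ 2 - 4 * b) = s ^ 2) :
    Affine.Point.some 0 0 h ∈ normSubgroup (twoTorsionModel a b) K' σ := by
  have hd0 : d ≠ 0 := by rintro rfl; exact hd IsSquare.zero
  have h2K : (2 : K') ≠ 0 := by
    intro h0
    apply h2
    apply (algebraMap F K').injective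
    rw [map_ofNat, map_zero]
    exact h0
  have h4K : (4 : K') ≠ 0 := by
    rw [show (4 : K') = 2 * 2 by norm_num]; exact mul_ne_zero h2K h2K
  have hσr : σ r = -r := algEquiv_sqrt_eq_neg h2f hσ hd hr
  -- `ℓ = w`, `A = a`, `B = b` in `K'`, and `z = (s/d)·r` with `z² = (ℓ² − A)² − 4B`, `σ z = −z`
  obtain ⟨A, hA⟩ : ∃ A : K', A = algebraMap F K' a := ⟨_, rfl⟩
  obtain ⟨B, hB⟩ : ∃ B : K', B = algebraMap F K' b := ⟨_, rfl⟩
  obtain ⟨ℓ, hℓ⟩ : ∃ ℓ : K', ℓ = algebraMap F K' w := ⟨_, rfl⟩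
  obtain ⟨z, hz⟩ : ∃ z : K', z = algebraMap F K' (s / d) * r := ⟨_, rfl⟩
  have hσA : σ A = A := by rw [hA]; exact AlgEquiv.commutes σ a
  have hσℓ : σ ℓ = ℓ := by rw [hℓ]; exact AlgEquiv.commutes σ w
  have hσz : σ z = -z := by rw [hz, map_mul, AlgEquiv.commutes, hσr, mul_neg]
  have hz2 : z ^ 2 = (ℓ ^ 2 - A) ^ 2 - 4 * B := by
    have hsd : (s / d) ^ 2 * d = (w ^ 2 - a) ^ 2 - 4 * b := by
      refine mul_left_cancel₀ hd0 ?_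
      have e1 : d * (s / d) = s := mul_div_cancel₀ s hd0
      calc d * ((s / d) ^ 2 * d) = (d * (s / d)) * (d * (s / d)) := by ring
        _ = s * s := by rw [e1]
        _ = d * ((w ^ 2 - a) ^ 2 - 4 * b) := by rw [← sq]; exact hws.symm
    rw [hz, mul_pow, hr, ← map_pow, ← map_mul, hsd, hℓ, hA, hB]
    simp only [map_sub, map_pow, map_mul, map_ofNat]
  -- the point `P = (x, ℓ x)`
  obtain ⟨x, hx⟩ : ∃ x : K', 2 * x = ℓ ^ 2 - A + z := ⟨(ℓ ^ 2 - A + z) / 2, mul_div_cancel₀ _ h2K⟩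
  have hxq : x ^ 2 - (ℓ ^ 2 - A) * x + B = 0 := by
    refine mul_left_cancel₀ h4K ?_
    linear_combination (2 * x - (ℓ ^ 2 - A) + z) * hx + hz2
  have hPeq : ((twoTorsionModel a b).baseChange K').toAffine.Equation x (ℓ * x) := by
    rw [model_equation_iff, ← hA, ← hB]
    linear_combination (-x) * hxq
  have hPns : ((twoTorsionModel a b).baseChange K').toAffine.Nonsingular x (ℓ * x) :=
    model_nonsingular_of_equation h2 hb hΔ hPeq
  -- its conjugate `σP = (σ x, ℓ σ x)` and `x + σ x = ℓ² − A`
  have hσx : 2 * σ x = ℓ ^ 2 - A - z := by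
    have hh := congrArg σ hx
    rw [map_mul, map_add, map_sub, map_pow, hσℓ, hσA, hσz, map_ofNat] at hh
    linear_combination hh
  have hsum : x + σ x = ℓ ^ 2 - A := by
    refine mul_left_cancel₀ h2K ?_
    linear_combination hx + hσx
  have hσy : (σ : K' →ₐ[F] K') (ℓ * x) = ℓ * σ x := by
    change σ (ℓ * x) = ℓ * σ x
    rw [map_mul, hσℓ]
  have hσx' : (σ : K' →ₐ[F] K') x = σ x := rfl
  refine (mem_normSubgroup_iff).mpr ⟨Affine.Point.some x (ℓ * x) hPns, ?_⟩
  rw [Affine.Point.map_some]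
  -- the slope of the line `y = ℓ x` through `P`, `σP` (chord, or tangent when `σP = P`)
  have hslope : ((twoTorsionModel a b).baseChange K').toAffine.slope x (σ x) (ℓ * x) (ℓ * σ x) = ℓ ∧
      ¬ (x = σ x ∧ ℓ * x = ((twoTorsionModel a b).baseChange K').toAffine.negY (σ x) (ℓ * σ x)) := by
    by_cases hxσ : x = σ x
    · -- tangent case: `z = 0`, `2x = ℓ² − A`, `B = x²`, `x ≠ 0`, `ℓ ≠ 0`
      have hz0 : z = 0 := by
        refine mul_left_cancel₀ h2K ?_
        linear_combination hσx - hx + 2 * hxσ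
      have hx2 : 2 * x = ℓ ^ 2 - A := by linear_combination hx + hz0
      have hBx : B = x ^ 2 := by linear_combination hxq - x * hx2
      have hx0 : x ≠ 0 := by
        intro hx0
        apply hb
        apply (algebraMap F K').injective
        rw [map_zero, ← hB, hBx, hx0, zero_pow two_ne_zero]
      have hℓ0 : ℓ ≠ 0 := by
        intro hℓ0
        apply hΔ
        apply (algebraMap F K').injective
        rw [map_zero, map_sub, map_mul, map_pow, map_ofNat, ← hA, ← hB]
        linear_combination (A - 2 * x + ℓ ^ 2) * hx2 + (-4 * x * ℓ + ℓ ^ 3) * hℓ0 - 4 * hBx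
      have h2ℓx : 2 * (ℓ * x) ≠ 0 := mul_ne_zero h2K (mul_ne_zero hℓ0 hx0)
      have hyne : ℓ * x ≠ ((twoTorsionModel a b).baseChange K').toAffine.negY (σ x) (ℓ * σ x) := by
        rw [model_negY, ← hxσ]
        intro hy
        exact h2ℓx (by linear_combination hy)
      refine ⟨?_, fun hc ↦ hyne hc.2⟩
      rw [Affine.slope_of_Y_ne hxσ hyne, model_negY]
      simp only [model_a₁, model_a₂, model_a₄, zero_mul, sub_zero]
      rw [← hA, ← hB, hBx, div_eq_iff (by intro h0; exact h2ℓx (by linear_combination h0))]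
      linear_combination (2 * x) * hx2
    · -- chord case
      refine ⟨?_, fun hc ↦ hxσ hc.1⟩
      rw [Affine.slope_of_X_ne hxσ, ← mul_sub, mul_div_assoc, div_self (sub_ne_zero.mpr hxσ), mul_one]
  obtain ⟨hℓslope, hne⟩ := hslope
  rw [Affine.Point.add_some (by rwa [hσx', hσy])]
  refine some_eq_some ?_ ?_
  · rw [hσx', hσy, hℓslope, Affine.addX]
    simp only [model_a₁, model_a₂]
    rw [← hA]
    linear_combination -hsum
  · rw [Affine.addY, Affine.negAddY, hσx', hσy, hℓslope, Affine.negY, Affine.addX]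
    simp only [model_a₁, model_a₂, model_a₃]
    rw [← hA]
    linear_combination ℓ * hsum

/-! ## §5 DESC-N, direction `⟹`: from `P + σP = T` to an `F`-point of the quartic -/

/-- **DESC-N, `⟹`**: if `T = (0,0) = P + σP` for some `P ∈ E(K')`, `K' = F(√d)`, then `d((w² − a)² − 4b) = s²` for some `w, s ∈ F`:
`P = (x, ℓx)` lies on the line `y = ℓx` through `T` with `σℓ = ℓ =: w`, `x` is a root of `X² + (a − w²)X + b`, and
`z = 2x + a − w²` (`z² = (w² − a)² − 4b`) has `σz = −z` (then `s = zr ∈ F`) or `σz = z` (then `z = 0`, `s = 0`).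
[cite: Kramer1981, Props. 1–7] [cite: SilvermanAEC2009, III.2.3] -/
theorem exists_quartic_of_torsion_mem_normSubgroup (h2 : (2 : F) ≠ 0) {a b d : F}
    (hd : ¬ IsSquare d) (h2f : Module.finrank F K' = 2) {σ : K' ≃ₐ[F] K'} (hσ : σ ≠ 1) {r : K'} (hr : r ^ 2 = algebraMap F K' d)
    (h : ((twoTorsionModel a b).baseChange K').toAffine.Nonsingular 0 0)
    (hT : Affine.Point.some 0 0 h ∈ normSubgroup (twoTorsionModel a b) K' σ) :
    ∃ w s : F, d * ((w ^ 2 - a) ^ 2 - 4 * b) = s ^ 2 := by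
  have h2K : (2 : K') ≠ 0 := by
    intro h0
    apply h2
    apply (algebraMap F K').injective
    rw [map_ofNat, map_zero]
    exact h0
  obtain ⟨A, hA⟩ : ∃ A : K', A = algebraMap F K' a := ⟨_, rfl⟩
  obtain ⟨B, hB⟩ : ∃ B : K', B = algebraMap F K' b := ⟨_, rfl⟩
  have hσA : σ A = A := by rw [hA]; exact AlgEquiv.commutes σ a
  have hσB : σ B = B := by rw [hB]; exact AlgEquiv.commutes σ b
  rw [mem_normSubgroup_iff] at hT
  obtain ⟨P, hP⟩ := hT
  rcases P with _ | ⟨x, y, hxy⟩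
  · rw [← Affine.Point.zero_def, map_zero, add_zero] at hP
    exact absurd hP.symm (Affine.Point.some_ne_zero _)
  rw [Affine.Point.map_some] at hP
  change Affine.Point.some x y hxy + Affine.Point.some (σ x) (σ y) _ = _ at hP
  -- the equation of `P` and of `σP`
  have heq : y ^ 2 = x ^ 3 + A * x ^ 2 + B * x := by
    have hh := (model_equation_iff K' a b x y).mp hxy.1
    rwa [← hA, ← hB] at hh
  have heqσ' : (σ y) ^ 2 = (σ x) ^ 3 + A * (σ x) ^ 2 + B * (σ x) := by
    have hh := congrArg σ heq
    rw [map_pow, map_add, map_add, map_mul, map_mul, map_pow, map_pow, hσA, hσB] at hh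
    exact hh
  have heqσ : ((twoTorsionModel a b).baseChange K').toAffine.Equation (σ x) (σ y) := by
    rw [model_equation_iff, ← hA, ← hB]
    exact heqσ'
  by_cases hneg : x = σ x ∧ y = ((twoTorsionModel a b).baseChange K').toAffine.negY (σ x) (σ y)
  · rw [Affine.Point.add_of_Y_eq hneg.1 hneg.2] at hP
    exact absurd hP (Affine.Point.some_ne_zero _).symm
  rw [Affine.Point.add_some hneg] at hP
  simp only [Affine.Point.some.injEq] at hP
  obtain ⟨hX, hY⟩ := hP
  obtain ⟨ℓ, hℓ⟩ : ∃ ℓ : K', ℓ = ((twoTorsionModel a b).baseChange K').toAffine.slope x (σ x) y (σ y) := ⟨_, rfl⟩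
  rw [← hℓ] at hX hY
  -- `addY = 0` with `addX = 0`: `y = ℓ x`
  rw [Affine.addY, Affine.negAddY, hX, model_negY] at hY
  have hyℓ : y = ℓ * x := by linear_combination -hY
  -- `addX = 0`: `x + σ x = ℓ² − A`
  rw [Affine.addX] at hX
  simp only [model_a₁, model_a₂, zero_mul, add_zero] at hX
  rw [← hA] at hX
  have hsum : x + σ x = ℓ ^ 2 - A := by linear_combination -hX
  -- `x ≠ 0` (else `P = T`, `σP = T = −P`)
  have hx0 : x ≠ 0 := by
    intro hx0
    apply hneg
    have hy0 : y = 0 := by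
      rw [hx0] at heq
      have : y ^ 2 = 0 := by rw [heq]; ring
      exact pow_eq_zero_iff (n := 2) (by norm_num) |>.mp this
    refine ⟨?_, ?_⟩
    · rw [hx0, map_zero]
    · rw [model_negY, hy0, map_zero, neg_zero]
  have hσx0 : σ x ≠ 0 := fun h0 ↦ hx0 ((map_eq_zero_iff σ σ.injective).mp h0)
  -- `σP` is on the same line: `σ y = ℓ σ x`
  have hσy : σ y = ℓ * σ x := by
    by_cases hxσ : x = σ x
    · have hyne : y ≠ ((twoTorsionModel a b).baseChange K').toAffine.negY (σ x) (σ y) := fun hc ↦ hneg ⟨hxσ, hc⟩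
      rcases Affine.Y_eq_of_X_eq hxy.1 heqσ hxσ with hyy | hyy
      · rw [← hyy, hyℓ, ← hxσ]
      · exact absurd hyy hyne
    · rw [Affine.slope_of_X_ne hxσ] at hℓ
      have hh : ℓ * (x - σ x) = y - σ y := by
        rw [hℓ]; exact div_mul_cancel₀ _ (sub_ne_zero.mpr hxσ)
      linear_combination hyℓ + hh
  -- `σ ℓ = ℓ`, so `ℓ = w ∈ F`
  have hσℓ : σ ℓ = ℓ := by
    have hh := congrArg σ hyℓ
    rw [map_mul, hσy] at hh
    exact (mul_right_cancel₀ hσx0 hh).symm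
  obtain ⟨w, hw⟩ := exists_eq_algebraMap_of_fixed_of_finrank_two h2f hσ hσℓ
  -- `x` is a root of `X² − (ℓ² − A)X + B`
  have hxq : x ^ 2 - (ℓ ^ 2 - A) * x + B = 0 := by
    have hh : x * (x ^ 2 - (ℓ ^ 2 - A) * x + B) = x * 0 := by
      rw [hyℓ] at heq
      linear_combination -heq
    exact mul_left_cancel₀ hx0 hh
  -- `z = 2x + A − ℓ²`, `z² = (ℓ² − A)² − 4B`, `(σz)² = z²`
  obtain ⟨z, hz⟩ : ∃ z : K', z = 2 * x + A - ℓ ^ 2 := ⟨_, rfl⟩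
  have hz2 : z ^ 2 = (ℓ ^ 2 - A) ^ 2 - 4 * B := by rw [hz]; linear_combination 4 * hxq
  have hσz : σ z = 2 * σ x + A - ℓ ^ 2 := by
    rw [hz, map_sub, map_add, map_mul, map_ofNat, map_pow, hσA, hσℓ]
  have hσz2 : (σ z) ^ 2 = z ^ 2 := by
    have hh := congrArg σ hz2
    rw [map_pow, map_sub, map_mul, map_pow, map_sub, map_pow, map_ofNat, hσℓ, hσA, hσB] at hh
    rw [hh, hz2]
  have hD : algebraMap F K' ((w ^ 2 - a) ^ 2 - 4 * b) = z ^ 2 := by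
    rw [hz2, hw, hA, hB]
    simp only [map_sub, map_pow, map_mul, map_ofNat]
  have h0 : (σ z - z) * (σ z + z) = 0 := by linear_combination hσz2
  rcases mul_eq_zero.mp h0 with hc | hc
  · -- `σ z = z`: then `σ x = x`, `z = 0`, `D = 0`, `s = 0`
    have hzz : σ z = z := sub_eq_zero.mp hc
    have hxx : σ x = x := by
      refine mul_left_cancel₀ h2K ?_
      linear_combination hzz - hσz + hz
    have hz0 : z = 0 := by linear_combination hz + hsum - hxx
    refine ⟨w, 0, ?_⟩
    have hD0 : (w ^ 2 - a) ^ 2 - 4 * b = 0 := by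
      apply (algebraMap F K').injective
      rw [hD, hz0, map_zero, zero_pow two_ne_zero]
    rw [hD0, mul_zero, zero_pow two_ne_zero]
  · -- `σ z = −z`: then `z r = s ∈ F` and `d·D = s²`
    have hzz : σ z = -z := eq_neg_of_add_eq_zero_left hc
    obtain ⟨c, hc'⟩ := exists_mul_sqrt_eq_algebraMap h2f hσ hd hr hzz
    refine ⟨w, c, ?_⟩
    apply (algebraMap F K').injective
    rw [map_pow, ← hc', mul_pow, hr, ← hD, ← map_mul, mul_comm]

/-! ## §6 DESC-N and DESC-C BY NAME -/

/-- **DESC-N `F1Sign2.TwoTorsionNormCriterion` HOLDS** (Lemma N of MEMO-desc §25, typed by -ty in `F1Sign2/RamifiedNormIndexFramesAtTwo.lean`):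
for any field `F` with `2 ≠ 0`, `E : y² = x(x² + ax + b)` with `b(a² − 4b) ≠ 0`, and a quadratic extension `K' = F(√d)` with non-trivial
automorphism `σ`: `T = (0,0) ∈ N_{K'/F} E(K')  ↔  ∃ w s : F, d((w² − a)² − 4b) = s²`. Proof: the line through `T` (§4, §5).
[cite: Kramer1981, Props. 1–7] [cite: SilvermanAEC2009, X.§4 Prop. 4.9] -/
theorem twoTorsionNormCriterion_holds : TwoTorsionNormCriterion := by
  intro F _ h2 a b d hb hΔ hd K' _ _ hK σ hσ r hr h
  exact ⟨exists_quartic_of_torsion_mem_normSubgroup h2 hd hK hσ hr h,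
    fun ⟨w, s, hws⟩ ↦ torsion_mem_normSubgroup_of_quartic h2 hb hΔ hd hK hσ hr h hws⟩

/-- **DESC-C `F1Sign2.TwoTorsionNormHilbertObstruction` HOLDS** (Lemma C of MEMO-desc §25): if `T = (0,0)` is a norm from `E(F(√d))`
then the Hilbert symbol `(b, d)_F = 1` — by -ty's proved reduction `twoTorsionNormHilbertObstruction_of_criterion` and DESC-N above.
[cite: Kramer1981, Props. 1–7] [cite: SilvermanAEC2009, X.§4 Prop. 4.9] -/
theorem twoTorsionNormHilbertObstruction_holds : TwoTorsionNormHilbertObstruction :=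
  twoTorsionNormHilbertObstruction_of_criterion twoTorsionNormCriterion_holds

end Summit.BirchSwinnertonDyer.BirchSwinnertonDyer.Theorems.GenusKolyTorsionNorm

end
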